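import Summits.CriticalPhenomena.CardyFormulaZ2.Theorems.CardyFlipRussoCoveringLegDefs
import Literature.Probability.RandomPlanarGeometry.ImageUnivalent
import Literature.Probability.RandomPlanarGeometry.ZoomFlow
import HarnessLib

/-!
# Frame bridge of line `five-arm-null` (crux `CardyFlipRusso.CoveringLeg`, stmt-CriticalPhenomena-6435): the rigid-motion transport

Helper file for the registered stub `stub_frameBridge : Sig.stub_frameBridge` (`SiteCardy →
CardySectorGap.CardyCentredSquare`) of the checked skeleton `Cruxes/CoveringLeg/Lines/five_arm_null.lean`
(vocabulary: `Theorems/CardyFlipRussoCoveringLegDefs.lean`).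

The two statements are Cardy's formula for crude site-`G_s` crossings at `q = ½`, read in two frames:
frame A (the crux: law `sitePercolation _ half`, graph `gS`, embedding `z = centredSquareEmbedding`)
and frame B (route CardySectorGap: law `lawP half`, graph `gsGraph`, embedding
`zS = ((1 − i) z + i)/√2 = ρ z + i/√2`, `ρ` the rotation by `−π/4`).  The laws agree (`lawP_half`)
and the graphs agree (`gS_eq_gsGraph`); this file proves the EXACT part of the bridge and isolates
the remaining analytic content:

* §A `frame_siteEmbDomainCrossing_eq_of_isometry` — the crude crossing event `siteEmbDomainCrossing`
  of an embedded graph is transported along any isometry `S` of the plane applied simultaneously to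
  the embedding and to the data `(Ω; A, B)` (`Metric.infDist_image`, injectivity); for the similarity
  `S = similarity c hc w`, `‖c‖ = 1`, the transported data of a marked domain `D` are those of
  `D.map S` (`frame_siteEmbDomainCrossing_eq_map`).
* §B `frame_hasCrossingLimit_of_map_similarity` — `HasCrossingLimit` passes from
  `R.map (similarity c hc w)` to `R` for every family `p` (same real boundary preimages, same
  cross-ratio; tree `ConformalRectangle.HasCrossingLimit.of_image_data`).
* §C the frame constants: `ρ = (1 − i)/√2`, `ρ⁻¹ = (1 + i)/√2`, the offset `i/√2` and the frame-A
  shift `w₀ = −ρ⁻¹ · i/√2 = (1 − i)/2` (half a cell diagonal: it swaps the positions of the type-I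
  sites and of the face centres, `frame_offset`), `zS = ρ · z + i/√2` (`frame_zS_eq`).
* §D `frame_lawP_half_crossS` — THE DICTIONARY: the frame-B crossing probability of `(R, δ)` is the
  frame-A crossing probability `siteProb` of the rigidly moved rectangle `ρ⁻¹ R + δ w₀` at the same
  mesh, i.e. of `(R.map (similarity ρ⁻¹ _ 0)).map (similarity 1 _ (δ w₀))`.
* §E `frame_cardyCentredSquare_iff_shifted` — hence `CardySectorGap.CardyCentredSquare` (stmt-7048) is
  EQUIVALENT to Cardy's formula in frame A for the discretisation by the lattice SHIFTED BY `δ w₀`: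
  `∀ R, R.HasCrossingLimit (fun δ ↦ siteProb (R.map (similarity 1 _ (δ w₀))) δ) cardyFunction`.
* §F `frame_bridge_of_shiftRobust` — the stub follows from ONE translation-robustness statement
  (Cardy in frame A for `R` ⇒ Cardy for the `δ w₀`-shifted discretisation of `R`), with the variants
  `frame_bridge_of_robust` (all shifts `δ w`, `‖w‖ ≤ 1`), `frame_bridge_of_robust'` (all shifts
  `c δ`, `‖c δ‖ ≤ δ`) and `frame_bridge_of_translationNull` (difference of the two crude crossing
  probabilities `→ 0`, the RSW form).  That robustness (uniform continuity of crude crossing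
  probabilities of critical site-`G_s` under an `O(δ)` translation of the domain relative to the
  lattice) is a boundary RSW statement not in the tree (Beffara 2008 §5.2; Garban–Pete–Schramm 2013
  §2; Köhler-Schindler–Tassion 2023); it is NOT proved here.

Sources: V. Beffara, *Is critical 2D percolation universal?*, Progr. Probab. 60 (2008) §1.2, §5.1–5.2
[Beffara2008Universal]; S. Smirnov, C. R. Acad. Sci. 333 (2001) §2 [Smirnov2001]; Ch. Pommerenke,
*Boundary Behaviour of Conformal Maps* (1992) Cor. 2.7 [PommerenkeBBCM1992].
-/

noncomputable section

namespace Summit.CriticalPhenomena.CardyFormulaZ2.Cruxes.CoveringLeg.FiveArmNull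

open Filter Set Topology
open Literature.Probability.RandomPlanarGeometry Literature.Probability.Percolation
open Literature.Probability.LatticeModels
open Literature.Barriers.CriticalPhenomena (MixedSite mixedParam)
open Summit.CriticalPhenomena.CardyFormulaZ2.Theses

/-! ### §A Rigid transport of crude site crossing events (any graph, any embedding) -/

/-- **Rigid transport of the crude site crossing event.** If an isometry `S` of the plane carries the
rescaled frame-B positions onto the rescaled frame-A positions, `S (δ z' y) = δ z y`, then the crude
crossing event of `(Ω; A, B)` for the embedding `z'` IS the crude crossing event of `(S Ω; S A, S B)`
for the embedding `z` (same graph, same mesh): `infDist` and membership are transported along `S`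
(`Metric.infDist_image`, injectivity of isometries). [folklore] -/
theorem frame_siteEmbDomainCrossing_eq_of_isometry {V : Type*} (G : SimpleGraph V) {z z' : V → ℂ}
    {S : ℂ → ℂ} (hS : Isometry S) {δ : ℝ} (hz : ∀ y, S ((δ : ℂ) * z' y) = (δ : ℂ) * z y)
    (Ω A B : Set ℂ) :
    siteEmbDomainCrossing G z' Ω δ A B = siteEmbDomainCrossing G z (S '' Ω) δ (S '' A) (S '' B) := by
  have hdist : ∀ (y : V) (E : Set ℂ),
      Metric.infDist ((δ : ℂ) * z' y) E = Metric.infDist ((δ : ℂ) * z y) (S '' E) := fun y E => by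
    rw [← hz y, Metric.infDist_image hS]
  have hmem : {y | (δ : ℂ) * z' y ∈ Ω} = {y | (δ : ℂ) * z y ∈ S '' Ω} := by
    ext y
    simp only [Set.mem_setOf_eq]
    rw [← hz y, hS.injective.mem_set_image]
  ext ω
  simp only [mem_siteEmbDomainCrossing_iff, hdist, hmem]

/-- A similarity `p ↦ c p + w` with `‖c‖ = 1` (a rigid motion of the plane) is an isometry. [folklore] -/
theorem frame_isometry_similarity {c : ℂ} (hc1 : ‖c‖ = 1) (hc : c ≠ 0) (w : ℂ) :
    Isometry (similarity c hc w) :=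
  Isometry.of_dist_eq fun x y => by
    rw [similarity_apply, similarity_apply, dist_eq_norm, dist_eq_norm, add_sub_add_right_eq_sub,
      ← mul_sub, norm_mul, hc1, one_mul]

/-- Rigid transport of the crude site crossing event of a marked domain: if the rigid motion
`S = (p ↦ c p + w)`, `‖c‖ = 1`, carries the rescaled frame-B positions onto the rescaled frame-A
positions, the frame-B event of `(D; arc i, arc j)` is the frame-A event of the moved marked domain
`D.map S` (carrier `S '' D`, arcs `S '' arc`). [cite: Beffara2008Universal, §1.2 Definition 3] -/
theorem frame_siteEmbDomainCrossing_eq_map {V : Type*} (G : SimpleGraph V) {z z' : V → ℂ} {c : ℂ}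
    (hc1 : ‖c‖ = 1) (hc : c ≠ 0) (w : ℂ) {δ : ℝ}
    (hz : ∀ y, c * ((δ : ℂ) * z' y) + w = (δ : ℂ) * z y) {n : ℕ} (D : MarkedDomain n) (i j : Fin n) :
    siteEmbDomainCrossing G z' D.carrier δ (D.arc i) (D.arc j) =
      siteEmbDomainCrossing G z (D.map (similarity c hc w)).carrier δ
        ((D.map (similarity c hc w)).arc i) ((D.map (similarity c hc w)).arc j) := by
  rw [MarkedDomain.carrier_map, MarkedDomain.arc_map, MarkedDomain.arc_map]
  exact frame_siteEmbDomainCrossing_eq_of_isometry G (frame_isometry_similarity hc1 hc w)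
    (fun y => (similarity_apply c hc w _).trans (hz y)) _ _ _

/-! ### §B Similar rectangles have the same crossing limits -/

/-- **Similarity covariance of `HasCrossingLimit`** (the direction used here): for every family
`p` and every `F`, if the image `R.map (similarity c hc w)` of `R` under `p ↦ c p + w` has crossing
limit `F` for `p` then so has `R` — a similarity carries uniformizing data `(φ, x)` of `R` to
`(s ∘ φ, x)` of `s R` (same real boundary preimages, same cross-ratio; tree
`ConformalRectangle.HasCrossingLimit.of_image_data`; the `iff` is the tree's
`CornerLineDescent.SymmetricSeed.Freeze.hasCrossingLimit_map_similarity_iff`).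
[cite: PommerenkeBBCM1992, Cor. 2.7] -/
theorem frame_hasCrossingLimit_of_map_similarity (R : ConformalRectangle) (c : ℂ) (hc : c ≠ 0)
    (w : ℂ) {p F : ℝ → ℝ} (h : ConformalRectangle.HasCrossingLimit (R.map (similarity c hc w)) p F) :
    R.HasCrossingLimit p F :=
  ConformalRectangle.HasCrossingLimit.of_image_data (R := R) (S := R.map (similarity c hc w))
    (h := fun z => c * z + w) (((differentiable_id.const_mul c).add_const w).differentiableOn)
    (fun _ _ _ _ hxy => mul_left_cancel₀ hc (add_right_cancel hxy))
    ((continuous_const.mul continuous_id).add continuous_const).continuousOn rfl (fun _ => rfl) h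

/-- **Transport of uniformizing data along a similarity**: if `(φ, x)` uniformizes the marked
domain `D` then `(s ∘ φ, x)` uniformizes `s D = D.map (similarity c hc w)` with the SAME real
boundary preimages `x` (tree `MarkedDomain.IsUniformizing.image_data`).
[cite: Beffara2008Universal, §1.2 Definition 3] -/
theorem frame_exists_isUniformizing_map_similarity {n : ℕ} (D : MarkedDomain n) (c : ℂ)
    (hc : c ≠ 0) (w : ℂ) {φ : ConformalEquiv UpperHalfPlane.upperHalfPlaneSet D.carrier}
    {x : Fin n → ℝ} (hφ : D.IsUniformizing φ x) :
    ∃ ψ : ConformalEquiv UpperHalfPlane.upperHalfPlaneSet (D.map (similarity c hc w)).carrier,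
      (D.map (similarity c hc w)).IsUniformizing ψ x :=
  ⟨_, hφ.image_data (S := D.map (similarity c hc w)) (h := fun z => c * z + w)
    (((differentiable_id.const_mul c).add_const w).differentiableOn)
    (fun _ _ _ _ hxy => mul_left_cancel₀ hc (add_right_cancel hxy))
    ((continuous_const.mul continuous_id).add continuous_const).continuousOn rfl fun _ => rfl⟩

/-! ### §C The frame constants `ρ = (1 − i)/√2`, `ρ⁻¹ = (1 + i)/√2`, `i/√2`, `w₀ = (1 − i)/2` -/

/-- `ρ⁻¹ ρ = 1`: `(1 + i)/√2 · (1 − i)/√2 = 1` (`(1 + i)(1 − i) = 2 = √2 · √2`). [folklore] -/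
theorem frame_rotInv_mul_rot :
    (1 + Complex.I) / (Real.sqrt 2 : ℂ) * ((1 - Complex.I) / (Real.sqrt 2 : ℂ)) = 1 := by
  have h : (1 + Complex.I) * (1 - Complex.I) = 2 := by
    ring_nf
    rw [Complex.I_sq]
    ring
  have hs : ((Real.sqrt 2 : ℝ) : ℂ) * ((Real.sqrt 2 : ℝ) : ℂ) = 2 := by
    rw [← Complex.ofReal_mul, Real.mul_self_sqrt zero_le_two]
    norm_num
  rw [div_mul_div_comm, hs, h, div_self two_ne_zero]

/-- The frame-A shift is minus `ρ⁻¹` of the frame-B offset: `(1 + i)/√2 · i/√2 + (1 − i)/2 = 0`.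
[folklore] -/
theorem frame_rotInv_mul_off_add_shift :
    (1 + Complex.I) / (Real.sqrt 2 : ℂ) * (Complex.I / (Real.sqrt 2 : ℂ)) + (1 - Complex.I) / 2 = 0 := by
  have h : (1 + Complex.I) * Complex.I + (1 - Complex.I) = 0 := by
    ring_nf
    rw [Complex.I_sq]
    ring
  have hs : ((Real.sqrt 2 : ℝ) : ℂ) * ((Real.sqrt 2 : ℝ) : ℂ) = 2 := by
    rw [← Complex.ofReal_mul, Real.mul_self_sqrt zero_le_two]
    norm_num
  rw [div_mul_div_comm, hs, ← add_div, h, zero_div]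

/-- `ρ⁻¹ = (1 + i)/√2` has norm `1` (it is the rotation by `+π/4`; `‖1 + i‖ = √2`). [folklore] -/
theorem frame_norm_rotInv : ‖(1 + Complex.I) / (Real.sqrt 2 : ℂ)‖ = 1 := by
  have h : ‖(1 : ℂ) + Complex.I‖ = Real.sqrt 2 := by
    rw [Complex.norm_def, Complex.normSq_apply]
    norm_num
  rw [norm_div, h, Complex.norm_of_nonneg (Real.sqrt_nonneg 2),
    div_self (Real.sqrt_pos.2 two_pos).ne']

/-- `ρ = (1 − i)/√2` has norm `1` (it is the rotation by `−π/4`; `‖1 − i‖ = √2`). [folklore] -/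
theorem frame_norm_rot : ‖(1 - Complex.I) / (Real.sqrt 2 : ℂ)‖ = 1 := by
  have h : ‖(1 : ℂ) - Complex.I‖ = Real.sqrt 2 := by
    rw [Complex.norm_def, Complex.normSq_apply]
    norm_num
  rw [norm_div, h, Complex.norm_of_nonneg (Real.sqrt_nonneg 2),
    div_self (Real.sqrt_pos.2 two_pos).ne']

/-- `ρ⁻¹ ≠ 0`. [folklore] -/
theorem frame_rotInv_ne_zero : (1 + Complex.I) / (Real.sqrt 2 : ℂ) ≠ 0 :=
  norm_ne_zero_iff.1 (by rw [frame_norm_rotInv]; exact one_ne_zero)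

/-- `ρ ≠ 0`. [folklore] -/
theorem frame_rot_ne_zero : (1 - Complex.I) / (Real.sqrt 2 : ℂ) ≠ 0 :=
  norm_ne_zero_iff.1 (by rw [frame_norm_rot]; exact one_ne_zero)

/-- The frame-A shift `w₀ = (1 − i)/2` (half a cell diagonal) has norm `√2/2 ≤ 1`. [folklore] -/
theorem frame_norm_shift_le_one : ‖(1 - Complex.I) / 2‖ ≤ 1 := by
  have h1 : ‖(1 : ℂ) - Complex.I‖ = Real.sqrt 2 := by
    rw [Complex.norm_def, Complex.normSq_apply]
    norm_num
  rw [norm_div, h1, Complex.norm_two, div_le_one two_pos]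
  have h := Real.sq_sqrt (zero_le_two)
  nlinarith [Real.sqrt_nonneg 2]

/-- **The frame identity** `z' = ρ z + i/√2`: CardySectorGap's embedding is the crux's embedding
rotated by `−π/4` and shifted by `i/√2` (from `zS_inl`, `zS_inr`). [cite: Beffara2008Universal, §5.1] -/
theorem frame_zS_eq (y : MixedSite) :
    zS y = (1 - Complex.I) / (Real.sqrt 2 : ℂ) * centredSquareEmbedding y +
      Complex.I / (Real.sqrt 2 : ℂ) := by
  rcases y with x | f
  · rw [zS_inl, add_div, div_mul_eq_mul_div]
  · rw [zS_inr, add_div, div_mul_eq_mul_div]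

/-- At mesh `δ`, the rigid motion `p ↦ ρ⁻¹ p + δ w₀` carries the frame-B position `δ z' y` of every
vertex onto its frame-A position `δ z y`. [cite: Beffara2008Universal, §5.1] -/
theorem frame_rotInv_mul_zS (δ : ℝ) (y : MixedSite) :
    (1 + Complex.I) / (Real.sqrt 2 : ℂ) * ((δ : ℂ) * zS y) + (δ : ℂ) * ((1 - Complex.I) / 2) =
      (δ : ℂ) * centredSquareEmbedding y := by
  rw [frame_zS_eq y]
  linear_combination ((δ : ℂ) * centredSquareEmbedding y) * frame_rotInv_mul_rot +
    (δ : ℂ) * frame_rotInv_mul_off_add_shift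

/-- Rotation then translation is one similarity: `(p ↦ ρ⁻¹ p) ≫ (p ↦ p + t) = (p ↦ ρ⁻¹ p + t)`.
[folklore] -/
theorem frame_rotInv_trans_shift (t : ℂ) :
    (similarity ((1 + Complex.I) / (Real.sqrt 2 : ℂ)) frame_rotInv_ne_zero 0).trans
        (similarity 1 one_ne_zero t) =
      similarity ((1 + Complex.I) / (Real.sqrt 2 : ℂ)) frame_rotInv_ne_zero t :=
  Homeomorph.ext fun p => by
    simp only [Homeomorph.trans_apply, similarity_apply]
    ring

/-- `ρ⁻¹ ∘ ρ = id` as plane homeomorphisms. [folklore] -/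
theorem frame_rot_trans_rotInv :
    (similarity ((1 - Complex.I) / (Real.sqrt 2 : ℂ)) frame_rot_ne_zero 0).trans
        (similarity ((1 + Complex.I) / (Real.sqrt 2 : ℂ)) frame_rotInv_ne_zero 0) =
      Homeomorph.refl ℂ :=
  Homeomorph.ext fun p => by
    simp only [Homeomorph.trans_apply, similarity_apply, Homeomorph.refl_apply, id_eq, add_zero]
    rw [← mul_assoc, frame_rotInv_mul_rot, one_mul]

/-- Rotating a marked domain by `ρ` and back gives the same marked domain. [folklore] -/
theorem frame_map_rot_map_rotInv {n : ℕ} (D : MarkedDomain n) :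
    (D.map (similarity ((1 - Complex.I) / (Real.sqrt 2 : ℂ)) frame_rot_ne_zero 0)).map
        (similarity ((1 + Complex.I) / (Real.sqrt 2 : ℂ)) frame_rotInv_ne_zero 0) = D := by
  rw [MarkedDomain.map_map, frame_rot_trans_rotInv, MarkedDomain.map_refl]

/-! ### §D The dictionary between the two frames -/

/-- **THE DICTIONARY.** For every conformal rectangle `R` and every mesh `δ`, the frame-B crude
crossing probability `(lawP ½).real (crossS R δ)` of route CardySectorGap EQUALS the frame-A crude
crossing probability `siteProb` (the crux's family) of the rigidly moved rectangle `ρ⁻¹ R + δ w₀`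
(`w₀ = (1 − i)/2`) at the same mesh: the laws agree (`lawP_half`), the graphs agree (`gS_eq_gsGraph`),
and the event is transported along the rigid motion `p ↦ ρ⁻¹ p + δ w₀`, which carries `δ z'` onto
`δ z` (`frame_rotInv_mul_zS`).  The translation part `δ w₀` depends on `δ` and is not a period of the
embedded lattice (`frame_offset`). [cite: Beffara2008Universal, §5.1] -/
theorem frame_lawP_half_crossS (R : ConformalRectangle) (δ : ℝ) :
    (lawP half).real (crossS R δ) =
      siteProb ((R.map (similarity ((1 + Complex.I) / (Real.sqrt 2 : ℂ)) frame_rotInv_ne_zero 0)).map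
        (similarity 1 one_ne_zero ((δ : ℂ) * ((1 - Complex.I) / 2)))) δ := by
  rw [lawP_half, crossS_eq, ← gS_eq_gsGraph, siteProb_eq, MarkedDomain.map_map,
    frame_rotInv_trans_shift, frame_siteEmbDomainCrossing_eq_map gS frame_norm_rotInv
      frame_rotInv_ne_zero ((δ : ℂ) * ((1 - Complex.I) / 2)) (frame_rotInv_mul_zS δ) R 0 2]

/-! ### §E `CardyCentredSquare` is Cardy's formula in frame A for the half-cell–shifted discretisation -/

/-- **Frame B = frame A shifted by half a cell diagonal.**  Route CardySectorGap's
`CardyCentredSquare` (stmt-7048) is EQUIVALENT to Cardy's formula, in the crux's own frame, for the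
crude crossing probabilities computed with the lattice translated by `δ w₀`, `w₀ = (1 − i)/2`, at
mesh `δ` — equivalently with the rectangle translated by `δ w₀`:
`∀ R, R.HasCrossingLimit (δ ↦ siteProb (R + δ w₀) δ) cardyFunction`.  (The rotation `ρ` is absorbed
exactly, `frame_hasCrossingLimit_of_map_similarity`; only the `δ`-dependent shift remains.)
[cite: Beffara2008Universal, §5.1] -/
theorem frame_cardyCentredSquare_iff_shifted :
    CardySectorGap.CardyCentredSquare ↔
      ∀ R : ConformalRectangle, R.HasCrossingLimit
        (fun δ : ℝ => siteProb (R.map (similarity 1 one_ne_zero ((δ : ℂ) * ((1 - Complex.I) / 2)))) δ)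
        cardyFunction := by
  rw [cardyCentredSquare_iff]
  constructor
  · intro h R₀
    have h1 := h (R₀.map (similarity ((1 - Complex.I) / (Real.sqrt 2 : ℂ)) frame_rot_ne_zero 0))
    simp only [frame_lawP_half_crossS] at h1
    rw [frame_map_rot_map_rotInv R₀] at h1
    exact frame_hasCrossingLimit_of_map_similarity R₀ _ frame_rot_ne_zero 0 h1
  · intro h R
    simp only [frame_lawP_half_crossS]
    exact frame_hasCrossingLimit_of_map_similarity R _ frame_rotInv_ne_zero 0
      (h (R.map (similarity ((1 + Complex.I) / (Real.sqrt 2 : ℂ)) frame_rotInv_ne_zero 0)))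

/-- The shifted frame-A family, unfolded: the crude crossing probability of the translate `R + t`
is that of the event `siteEmbDomainCrossing gS z (Ω + t) δ (arc₀ + t) (arc₂ + t)` (carrier and
arcs translated by `t`). [cite: Smirnov2001, §2] -/
theorem frame_siteProb_map_translate (R : ConformalRectangle) (t : ℂ) (δ : ℝ) :
    siteProb (R.map (similarity 1 one_ne_zero t)) δ =
      (sitePercolation MixedSite half).real (siteEmbDomainCrossing gS centredSquareEmbedding
        ((· + t) '' R.carrier) δ ((· + t) '' R.arc 0) ((· + t) '' R.arc 2)) := by
  have h : ((similarity 1 one_ne_zero t : ℂ ≃ₜ ℂ) : ℂ → ℂ) = (· + t) :=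
    funext fun p => by rw [similarity_apply, one_mul]
  rw [siteProb_eq, MarkedDomain.carrier_map, MarkedDomain.arc_map, MarkedDomain.arc_map, h]

/-- **The exact content of the stub.** `Sig.stub_frameBridge` (`SiteCardy →
CardySectorGap.CardyCentredSquare`) is EQUIVALENT to: Cardy's formula for the crude site-`G_s`
crossings in frame A (`SiteCardy`) implies Cardy's formula for the same crude crossings computed with
the lattice shifted by half a cell diagonal, `δ w₀` at mesh `δ` (`w₀ = (1 − i)/2`).  Everything else
(laws, graphs, the rotation by `−π/4`) is absorbed exactly. [cite: Beffara2008Universal, §5.1] -/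
theorem frame_stub_iff :
    Sig.stub_frameBridge ↔
      (SiteCardy → ∀ R : ConformalRectangle, R.HasCrossingLimit
        (fun δ : ℝ => siteProb (R.map (similarity 1 one_ne_zero ((δ : ℂ) * ((1 - Complex.I) / 2)))) δ)
        cardyFunction) :=
  imp_congr_right fun _ => frame_cardyCentredSquare_iff_shifted

/-! ### §F The stub modulo translation robustness -/

/-- **The frame bridge modulo robustness under the half-cell shift.**  If, for every conformal
rectangle `R`, Cardy's formula for the crude site-`G_s` crossing probabilities of `R` (frame A) implies
Cardy's formula for the crude crossing probabilities of the translates `R + δ w₀` at mesh `δ`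
(`w₀ = (1 − i)/2`, half a cell diagonal: an `O(δ)` shift of the domain relative to the lattice — a
boundary RSW statement, Beffara 2008 §5.2, Garban–Pete–Schramm 2013 §2, NOT proved in the tree), then
the registered stub `Sig.stub_frameBridge : SiteCardy → CardySectorGap.CardyCentredSquare` holds
(`frame_cardyCentredSquare_iff_shifted`). [cite: Beffara2008Universal, §5.2] -/
theorem frame_bridge_of_shiftRobust : (∀ R : Literature.Probability.RandomPlanarGeometry.ConformalRectangle, R.HasCrossingLimit (Summit.CriticalPhenomena.CardyFormulaZ2.Cruxes.CoveringLeg.FiveArmNull.siteProb R) Literature.Probability.RandomPlanarGeometry.cardyFunction → R.HasCrossingLimit (fun δ : ℝ => Summit.CriticalPhenomena.CardyFormulaZ2.Cruxes.CoveringLeg.FiveArmNull.siteProb (R.map (Literature.Probability.RandomPlanarGeometry.similarity 1 one_ne_zero ((δ : ℂ) * ((1 - Complex.I) / 2)))) δ) Literature.Probability.RandomPlanarGeometry.cardyFunction) → Summit.CriticalPhenomena.CardyFormulaZ2.Cruxes.CoveringLeg.FiveArmNull.Sig.stub_frameBridge := by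
  intro hRobust hSite
  exact frame_cardyCentredSquare_iff_shifted.2 fun R => hRobust R (hSite R)

/-- Variant: robustness under ALL bounded linear shifts `δ w`, `‖w‖ ≤ 1`, suffices
(`‖w₀‖ = √2/2 ≤ 1`). [cite: Beffara2008Universal, §5.2] -/
theorem frame_bridge_of_robust
    (hRobust : ∀ (R : ConformalRectangle) (w : ℂ), ‖w‖ ≤ 1 →
      R.HasCrossingLimit (siteProb R) cardyFunction →
        R.HasCrossingLimit
          (fun δ : ℝ => siteProb (R.map (similarity 1 one_ne_zero ((δ : ℂ) * w))) δ) cardyFunction) :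
    Sig.stub_frameBridge :=
  frame_bridge_of_shiftRobust fun R hR => hRobust R ((1 - Complex.I) / 2) frame_norm_shift_le_one hR

/-- Variant: robustness under ALL shifts `c δ` with `‖c δ‖ ≤ δ` for `δ > 0` suffices.
[cite: Beffara2008Universal, §5.2] -/
theorem frame_bridge_of_robust'
    (hRobust : ∀ (R : ConformalRectangle) (c : ℝ → ℂ), (∀ δ : ℝ, 0 < δ → ‖c δ‖ ≤ δ) →
      R.HasCrossingLimit (siteProb R) cardyFunction →
        R.HasCrossingLimit (fun δ : ℝ => siteProb (R.map (similarity 1 one_ne_zero (c δ))) δ)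
          cardyFunction) :
    Sig.stub_frameBridge :=
  frame_bridge_of_robust fun R w hw hR => hRobust R (fun δ : ℝ => (δ : ℂ) * w) (fun δ hδ => by
    rw [norm_mul, Complex.norm_of_nonneg hδ.le]
    exact mul_le_of_le_one_right hδ.le hw) hR

/-- Variant (the RSW form): if the crude frame-A crossing probabilities of `R` and of its translates
`R + δ w₀` at mesh `δ` differ by `o(1)` as `δ → 0⁺` (uniform continuity of crude crossing
probabilities under an `O(δ)` translation of the domain relative to the lattice), the stub holds.
[cite: Beffara2008Universal, §5.2] -/
theorem frame_bridge_of_translationNull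
    (hNull : ∀ R : ConformalRectangle,
      Tendsto (fun δ : ℝ => siteProb (R.map (similarity 1 one_ne_zero ((δ : ℂ) * ((1 - Complex.I) / 2)))) δ
        - siteProb R δ) (𝓝[>] 0) (𝓝 0)) :
    Sig.stub_frameBridge := by
  refine frame_bridge_of_shiftRobust fun R hR => ?_
  intro φ x hφ
  have h := (hR φ x hφ).add (hNull R)
  rw [add_zero] at h
  exact h.congr fun δ => by ring

end Summit.CriticalPhenomena.CardyFormulaZ2.Cruxes.CoveringLeg.FiveArmNull

end
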